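import Summits.BirchSwinnertonDyer.BirchSwinnertonDyer.Theorems.KolyvaginRankRigidityAtTwoWalkRounds
import Summits.BirchSwinnertonDyer.BirchSwinnertonDyer.Theorems.KolyvaginRankRigidityAtTwoSwapOfNamedFacts
import Summits.BirchSwinnertonDyer.BirchSwinnertonDyer.Theorems.PoitouTateSelmerStructureDualityConjHolds
import Summits.BirchSwinnertonDyer.Rank1Residual.X11b.KolyvaginHpointsAssembly
import HarnessLib

/-!
# Crux U1 `KolyvaginBoundedDefectAtTwo` (stmt-BirchSwinnertonDyer-28083), LINE 17 `regular_core_rigidity`,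
# stub S1b `stub_nearCoreExistenceAtTwo` — THE WALK, part 4: S1b FROM A START FRAME (the frame data discharged)

Width seat `bsd-line-krr2-p2` g15 (ONE READER on S1b); `--supports stmt-BirchSwinnertonDyer-28083` (helper).
THEOREMS ONLY; nothing here proves S1b outright, U1, a rung or BSD. BSD is NOT proved.

`nearCoreExistenceAtTwo_of_startFrame`: the conclusion is VERBATIM the body of the registered stub S1b
`NearCoreExistenceAtTwo` (LINE 17 v3, `HOME/line17/regular_core_rigidity.lean`), so `fun h ↦ nearCoreExistenceAtTwo_of_startFrame h`
closes `StartFrame → NearCoreExistenceAtTwo` by `exact` once the LEAD registers the start-frame stub. The HYPOTHESIS (the only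
residual input of S1b, «N3″» in the pen's numbering) is a START FRAME at every level `2^k` of the Selmer group
`Sel_{2^k}(E/K) = H_{𝓕(1)}`: an ODD number `m` of `τ_*`-eigenclasses `g₁ … g_m` with a level-INDEPENDENT sign pattern, one of
them (`g_{i₀}`) of exact order `2^k`, generating `Sel_{2^k}` up to `2^J` and the inflation kernel `ker res_{k+1}` (F3), and
independent modulo `2^(k−d)` and that kernel (F4), with `m, J, d` independent of `k`. (From the divisible part `D ≅ (ℚ₂/ℤ₂)^{r_∞}`
of `Sel_{2^∞}(E/K)`: `D = (1+τ)D + (1−τ)D` gives the eigenframe with `m = r_∞`, `J = 1 + log₂ #(Sel_{2^∞}/D)`, `d = 2`; `m` odd is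
2-PARITY over `K` — Kramer 1981 / Monsky 1996, the print input the ONE READER g14 showed to be necessary.) The proof: per level,
a `τ`-equivariant Weil datum (`exists_weilDatum_liftAut_two_pow`), the tree's Poitou–Tate package
(`poitouTate_selmerStructure_duality_conj_holds`), and the walk `walk_rounds` from the vertex `c = 1`; the error exponent is
`κ = J' + 1` with `J'` the walk's level-free exponent (Sah at `2` turns `ker res_{k+1}` into one more bit); the depth is
`r = max P N` of the sign census. [cite: MazurRubin2004, Cor. 2.7.3, §4.1 Prop. 4.1.5] [cite: Jetchev2008, §5.2, Prop. 5.3]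
[cite: GrossLMS1991, §9 Prop. 9.1] [cite: Kramer1981, Thm. 1] [cite: Monsky1996, Lemma 1.4(b)]
Design: no definitions; `K : Type`; axioms `propext`, `Classical.choice`, `Quot.sound`.
-/

set_option autoImplicit false
-- the Theorems namespace of this sub repeats the summit name by design (D-0017 nested layout)
set_option linter.dupNamespace false

noncomputable section

open scoped Classical
open Function NumberField IsDedekindDomain WeierstrassCurve Field Finset
open Literature.NumberTheory.EllipticCurves Literature.NumberTheory.EllipticCurves.Jetchev2008
open Literature.NumberTheory.EllipticCurves.KolyvaginPairing
open Literature.NumberTheory.GaloisRepresentations Literature.NumberTheory.GaloisCohomology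
open Literature.NumberTheory.GaloisRepresentations.DiscreteGaloisModule (transverseSubgroup SelmerStructure)
open Literature.NumberTheory.Automorphic Literature.NumberTheory
open Summit.BirchSwinnertonDyer.Rank1Residual
open Summit.BirchSwinnertonDyer.Rank1Residual.JET.SelmerVocabulary
open Summit.BirchSwinnertonDyer.BirchSwinnertonDyer.Theorems.KolyvaginLowerBoundAtTwo (torsionFixing_le_of_dvd
  exists_weilDatum_liftAut_two_pow)

namespace Summit.BirchSwinnertonDyer.BirchSwinnertonDyer.Theorems.KolyvaginAtTwo.RegularWalk

set_option maxHeartbeats 800000 in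
/-- **S1b (`NearCoreExistenceAtTwo`, LINE 17 v3, VERBATIM) FROM A START FRAME.** See the module docstring: the
regular-prime walk (parts 0–3) run at every level from `Sel_{2^k}(E/K)`, with the Weil datum and the Poitou–Tate package of
the tree; depth `r = max P N` (sign census of the start frame) and error `κ = J' + 1` are level-free.
[cite: MazurRubin2004, Cor. 2.7.3, §4.1 Prop. 4.1.5] [cite: Jetchev2008, Prop. 5.3] [cite: GrossLMS1991, §9 Prop. 9.1] -/
theorem nearCoreExistenceAtTwo_of_startFrame
    (hSF : ∀ (W : WeierstrassCurve ℚ) [W.IsElliptic] [W.IsGloballyMinimal], ¬ W.HasCM → (Literature.NumberTheory.EllipticCurves.Rank1Residual.GoodOrd W 2 ∨ Literature.NumberTheory.EllipticCurves.Rank1Residual.Mult W 2) → (∀ m : ℕ, W.HasSurjectiveModNGaloisRep (2 ^ m : ℕ)) → ∀ (K : Type) [Field K] [NumberField K], Literature.NumberTheory.EllipticCurves.IsImaginaryQuadratic K → ∀ [NeZero (W.conductorNorm ℤ)], Literature.NumberTheory.EllipticCurves.SatisfiesHeegnerHypothesis (W.conductorNorm ℤ) K → Odd (NumberField.discr K)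 → NumberField.discr K ≠ -3 → AddSubgroup.torsionBy (W.baseChange K).toAffine.Point (2 : ℤ) = ⊥ → Literature.NumberTheory.EllipticCurves.SatisfiesHeegnerHypothesis 2 K → ∀ (Dt : Literature.NumberTheory.EllipticCurves.ModularForms.ModularParametrizationData W (W.conductorNorm ℤ)) (β : ℤ) (ι : K →+* ℂ) [∀ k : ℕ, NumberField (ringClassField K ι k)], (4 * (W.conductorNorm ℤ : ℤ)) ∣ β ^ 2 - NumberField.discr K → ∀ (τ : K ≃ₐ[ℚ] K), τ ≠ 1 →
      ∃ (m : ℕ) (sg : Fin m → ℤ) (i₀ : Fin m) (J d : ℕ), Odd m ∧ (∀ i, sg i = 1 ∨ sg i = -1) ∧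
        ∀ k : ℕ, 1 ≤ k → ∃ g : Fin m → galH1Torsion (W.baseChange K) ((2 ^ k : ℕ) : ℤ),
          (∀ i, g i ∈ Jetchev2008.modifiedSelmerGroup W K ι ((2 ^ k : ℕ) : ℤ) 1) ∧
          (∀ i, conjAct W τ ((2 ^ k : ℕ) : ℤ) (g i) = sg i • g i) ∧ addOrderOf (g i₀) = 2 ^ k ∧
          (∀ u : galH1Torsion (W.baseChange K) ((2 ^ k : ℕ) : ℤ),
            u ∈ Jetchev2008.modifiedSelmerGroup W K ι ((2 ^ k : ℕ) : ℤ) 1 → ∃ b : Fin m → ℤ,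
              ∀ ρ ∈ torsionFixing (W.baseChange K) ((2 ^ (k + 1) : ℕ) : ℤ),
                h1Eval (W.baseChange K) ((2 ^ k : ℕ) : ℤ) (((2 : ℤ) ^ J) • u - ∑ i, b i • g i) ρ = 0) ∧
          (∀ b : Fin m → ℤ, (∀ ρ ∈ torsionFixing (W.baseChange K) ((2 ^ (k + 1) : ℕ) : ℤ),
              h1Eval (W.baseChange K) ((2 ^ k : ℕ) : ℤ) (∑ i, b i • g i) ρ = 0) → ∀ i, (2 : ℤ) ^ (k - d) ∣ b i)) :
    ∀ (W : WeierstrassCurve ℚ) [W.IsElliptic] [W.IsGloballyMinimal], ¬ W.HasCM → (Literature.NumberTheory.EllipticCurves.Rank1Residual.GoodOrd W 2 ∨ Literature.NumberTheory.EllipticCurves.Rank1Residual.Mult W 2) → (∀ m : ℕ, W.HasSurjectiveModNGaloisRep (2 ^ m : ℕ)) → ∀ (K : Type) [Field K] [NumberField K], Literature.NumberTheory.EllipticCurves.IsImaginaryQuadratic K → ∀ [NeZero (W.conductorNorm ℤ)], Literature.NumberTheory.EllipticCurves.SatisfiesHeegnerHypothesis (W.conductorNorm ℤ) K → Odd (NumberField.discr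 K) → NumberField.discr K ≠ -3 → AddSubgroup.torsionBy (W.baseChange K).toAffine.Point (2 : ℤ) = ⊥ → Literature.NumberTheory.EllipticCurves.SatisfiesHeegnerHypothesis 2 K → ∀ (Dt : Literature.NumberTheory.EllipticCurves.ModularForms.ModularParametrizationData W (W.conductorNorm ℤ)) (β : ℤ) (ι : K →+* ℂ) [∀ k : ℕ, NumberField (ringClassField K ι k)], (4 * (W.conductorNorm ℤ : ℤ)) ∣ β ^ 2 - NumberField.discr K →
    ∃ r κ : ℕ, ∀ (M b : ℕ), 1 ≤ M →
      ∃ n : ℕ, Squarefree n ∧ n.primeFactors.card = r ∧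
        (∀ ℓ ∈ n.primeFactors, Literature.NumberTheory.EllipticCurves.Zhang2014.IsKolyvaginPrime (W.conductorNorm ℤ) W K 2 ℓ ∧ b < ℓ ∧
          M ≤ Literature.NumberTheory.EllipticCurves.Zhang2014.kolyvaginIndex W 2 ℓ ∧ (∃ (v : HeightOneSpectrum (𝓞 ℚ)) (𝔓 : Ideal (absIntegers (𝓞 ℚ) ℚ)) (h : absoluteGaloisGroup ℚ), (ℓ : 𝓞 ℚ) ∈ v.asIdeal ∧ 𝔓 ∈ v.primesAbove ∧ IsArithFrobAt (𝓞 ℚ) h 𝔓 ∧ (∀ X : geomTorsion W ((2 ^ M : ℕ) : ℤ), h • h • X = X) ∧ ∃ P : geomTorsion W ((2 ^ M : ℕ) : ℤ), (2 : ℤ) ^ (M - 1) • (P + h • P) ≠ 0)) ∧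
        (∃ x ∈ Jetchev2008.modifiedSelmerGroup W K ι ((2 ^ M : ℕ) : ℤ) n, addOrderOf x = 2 ^ M ∧ ∀ y ∈ Jetchev2008.modifiedSelmerGroup W K ι ((2 ^ M : ℕ) : ℤ) n, ∃ t : ℤ, (2 ^ κ : ℤ) • y = t • x) := by
  intro W _ _ hCM hred hsur K _ _ hK _ hH hodd hd3 htors hH2 Dt β ι _ hβ
  classical
  obtain ⟨τ, hτ1⟩ := JET.exists_algEquiv_ne_one_of_isImaginaryQuadratic K hK
  obtain ⟨m, sg, i₀, J, d, ⟨t, ht⟩, hsg, hframe⟩ := hSF W hCM hred hsur K hK hH hodd hd3 htors hH2 Dt β ι hβ τ hτ1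
  obtain ⟨J', hJ'⟩ := walk_rounds (K := K) W t J d
  refine ⟨max ((Finset.univ.erase i₀).filter (fun i ↦ sg i = 1)).card ((Finset.univ.erase i₀).filter (fun i ↦ sg i = -1)).card,
    J' + 1, fun M b hM ↦ ?_⟩
  obtain ⟨g, hgS, hgτ, hord, hF3, hF4⟩ := hframe M hM
  -- the frame data at level `2^M`
  have hne4 : NumberField.discr K ≠ -4 := fun h ↦ by rw [h] at hodd; exact absurd hodd (by decide)
  have hD : NumberField.discr K < -4 := X11b.KolyvaginAssembly.discr_lt_neg_four hK ⟨hd3, hne4⟩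
  obtain ⟨inv, hperf, hvan, -, hSC, hconj⟩ := InputsPoitouTateSelmer.poitouTate_selmerStructure_duality_conj_holds K (2 ^ M)
  obtain ⟨e, hμ, hadd₁, hadd₂, hgal, halt, hnondeg, hτe⟩ := exists_weilDatum_liftAut_two_pow (K := K) W τ M
  have hs2 : W.HasSurjectiveModNGaloisRep 2 := by simpa using hsur 1
  have hcard0 : (Finset.univ.erase i₀ : Finset (Fin m)).card = 2 * t := by
    rw [Finset.card_erase_of_mem (Finset.mem_univ _), Finset.card_univ, Fintype.card_fin]; omega
  obtain ⟨c', hc', hcard, hprimes, hx₀, hfin⟩ := hJ' M hM e hμ hadd₁ hadd₂ hgal halt hnondeg inv hperf hvan hSC hK hD hodd ι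
    hH hs2 (hsur (M + 1)) τ hτ1 hτe (hconj τ) b 1 squarefree_one (by simp [Nat.primeFactors_one]) m g sg Finset.univ i₀
    (Finset.mem_univ _) (fun i _ ↦ hgS i) hsg hgτ hcard0 (fun u hu ↦ hF3 u hu) (fun b' hb' i _ ↦ hF4 b' hb' i)
  refine ⟨c', hc', by rw [hcard, Nat.primeFactors_one, Finset.card_empty, zero_add], fun ℓ hℓ ↦ ?_, g i₀, hx₀, hord, ?_⟩
  · obtain ⟨hKol, hidx, hbℓ, hreg⟩ := hprimes ℓ hℓ
    exact ⟨hKol, hbℓ, by omega, hreg⟩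
  · intro y hy
    obtain ⟨bb, hbb⟩ := hfin y hy
    refine ⟨2 * bb, ?_⟩
    obtain ⟨y', rfl⟩ : ∃ y' : galH1Torsion (W.baseChange K) ((2 ^ M : ℕ) : ℤ), y' = y := ⟨y, rfl⟩
    have h2 : (2 : ℤ) • (((2 : ℤ) ^ J') • y' - bb • g i₀) = 0 := two_zsmul_eq_zero_of_res_eq_zero W hK (hsur (M + 1)) hbb
    rw [zsmul_sub, zsmul_zsmul_eq_mul_zsmul, zsmul_zsmul_eq_mul_zsmul, sub_eq_zero, ← pow_succ'] at h2
    exact h2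

end Summit.BirchSwinnertonDyer.BirchSwinnertonDyer.Theorems.KolyvaginAtTwo.RegularWalk

end
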